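import Literature.NumberTheory.EllipticCurves.Curve15A1Descent
import HarnessLib

/-!
# Route `Langlands/SqrtFiveQuarticCovers` — rank `0` of the quadratic twist of `X₀(15)` by `5`:
# `E₇₅ : y² = x³ + 25x² − 3800x − 78000 = (x + 20)(x + 65)(x − 60)` has finitely many rational points

Cell lg-quartmod (F-L1), seat eng-6 g4 (lead ruling 2026-08-29T00:12:44Z; helper of stmt-Langlands-23415).
The lineages behind rows 1 and 6 of the NAMED-INPUT TABLE (`hE6c` via `X₀(75)/w₂₅`: R / E6′ / E13;
`hE9c` via `D₁ = 15a8`: E9′ / E9P3) NAME «the isogeny class `15a` and its twist `75b = 15a ⊗ χ₅` have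
rank `0` over `k = ℚ(√5)`» (exact `L`-values + Kolyvagin–Logachev, or `mwrank`).  The tree PROVES
`rank X₀(15)(ℚ) = 0` (`Curve15A1.finite_point`, complete `2`-descent) and the quadratic finiteness
transfer (`WeierstrassCurve.finite_point_baseChange_of_finite_of_finite_quadraticTwist`); the missing
piece is the twist, proved here: `Twist75.finite_point : Finite (E₇₅)(ℚ)`, `E₇₅ = ⟨0, 25, 0, -3800, -78000⟩`
`= (1/2, 0, 0, 0) • (X₀(15)).quadraticTwist 5` (`X₀(15) = 15A1 = [1,1,1,-10,-10]`, `Y² = (X+4)(X+13)(X−12)`;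
twist `5Y² = …`, rescale by `5`: roots `−20, −65, 60`), conductor `75`, Cremona class `75b` (Sage label
of the cell's record).  Companion: `…Rank0FifteenSqrtFive.lean` («`X₀(15)(K)` finite for quadratic `K ∋ √5`»).

METHOD (VERBATIM `Curve15A1Descent.lean`; Silverman *AEC* Prop. X.1.4 / Example X.1.5, `S = {2,3,5,∞}`),
components `(x − 60, x + 65)`.  For a rational point with `y ≠ 0`: `ord_p(x − 60)` is even for
`p ∉ {2, 5}` (root differences `80`, `125`), `ord_p(x + 65)` even for `p ∉ {3, 5}` (`45`, `125`)
(`Curve24A1.even_padicValRat_sub`), so `|x − 60| ∈ {1,2,5,10}·u²`, `x + 65 ∈ {1,3,5,15}·w²` (`x + 65 > 0`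
as `y² > 0`; `Curve15A1.exists_abs_eq_sq_or₂`); EIGHT local computations (`Curve15A1.not_sq_of_quartic`,
a `decide` over `ZMod 3` or `ZMod 16` each) exclude `x − 60 ∈ {2, 5, −1, −10}·u²` (mod `3`),
`x − 60 ∈ {10, −2}·u²` and `x + 65 ∈ {3, 15}·w²` (mod `16`).  Hence the `2`-descent pair lies in
`S = {1, [−5]} × {1, [5]}` (`descentPair_mem`) = the classes of `O, (60,0), (−65,0), (−20,0)`, so
`2^(r+2) ≤ 4` (`pow_finrank_add_two_le_natCard_range` with `T₁ = (60,0)`, `T₂ = (−65,0)`), `r = 0`, and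
`E₇₅(ℚ)` is finite by the tree's Mordell–Weil theorem (`module_finite_point_holds`,
`finite_point_of_mordellWeilRank_eq_zero`).  Numerics (kit j321188, PARI 2.17 / Sage): `15a8` and
`75b1 = 15a8 ⊗ χ₅` have `ellrank = [0,0,0,[]]`; obstruction moduli from `work/k15/kills.py`.

HONEST STATUS: an unconditional kernel theorem about the rational points of ONE explicit elliptic curve
over `ℚ` (conductor `75`); not a BSD or modularity statement; it closes no binder of the route's Record
(it turns a NAMED rank-`0` input used inside two lineage documents into a kernel theorem); nothing here
proves modularity of a new class of elliptic curves.  References: [SilvermanAEC2009] Prop. X.1.4,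
Example X.1.5, Thm. VIII.6.7; [CremonaAlgorithms1997] Table 1, `N = 75`, and §3.6 (`mwrank`'s method).
-/

noncomputable section

open WeierstrassCurve WeierstrassCurve.Affine WeierstrassCurve.Affine.Point

set_option linter.dupNamespace false -- project-wide option; `Summit.Langlands.Langlands` is the mandated namespace

namespace Summit.Langlands.Langlands.Theorems.SqrtFiveQuarticCovers

namespace Twist75

open Literature.NumberTheory.EllipticCurves Literature.NumberTheory.EllipticCurves.Curve24A1
  Literature.NumberTheory.EllipticCurves.Curve15A1

/-! ### The arithmetic core: square classes of `x − 60` and `x + 65` on `E₇₅` -/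

/-- **The `2`-descent on `E₇₅`, arithmetic core** (Silverman, *AEC*, Example X.1.5 carried out
for `y² = (x − 60)(x + 65)(x + 20)`, `S = {2, 3, 5, ∞}`): for rationals with `y ≠ 0` there are
non-zero rationals `u, w` with `x − 60 ∈ {u², −5u²}` and `x + 65 ∈ {w², 5w²}`.  Proof: valuations
away from `{2, 5}` resp. `{3, 5}` (`even_padicValRat_sub`), the sign `x + 65 > 0`, and eight local
computations excluding `x − 60 = 2u², 5u², 10u², −u², −2u², −10u²` and `x + 65 = 3w², 15w²`
(`not_sq_of_quartic` modulo `3` or `16`). [cite: SilvermanAEC2009, Example X.1.5 (method)] -/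
theorem exists_sq_of_sq_eq {x y : ℚ} (hy : y ≠ 0)
    (h : y ^ 2 = x ^ 3 + 25 * x ^ 2 - 3800 * x - 78000) :
    ∃ u w : ℚ, u ≠ 0 ∧ w ≠ 0 ∧ (x - 60 = u ^ 2 ∨ x - 60 = -5 * u ^ 2) ∧
      (x + 65 = w ^ 2 ∨ x + 65 = 5 * w ^ 2) := by
  have hfac : y ^ 2 = (x - 60) * (x + 65) * (x + 20) := by rw [h]; ring
  have h₀ : (x - 60) * (x + 65) * (x + 20) ≠ 0 := hfac ▸ pow_ne_zero 2 hy
  have hx₁ : x - 60 ≠ 0 := fun h0 => h₀ (by rw [h0, zero_mul, zero_mul])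
  have hx₂ : x + 65 ≠ 0 := fun h0 => h₀ (by rw [h0, mul_zero, zero_mul])
  have hx₃ : x + 20 ≠ 0 := fun h0 => h₀ (by rw [h0, mul_zero])
  haveI : Fact (Nat.Prime 5) := ⟨Nat.prime_five⟩
  -- parities of valuations at the primes not dividing the differences `80, 125` resp. `45, 125`
  have P₁ : ∀ p : ℕ, p.Prime → p ≠ 2 → p ≠ 5 → Even (padicValRat p (x - 60)) := by
    intro p hp hp2 hp5
    haveI := Fact.mk hp
    refine even_padicValRat_sub p (e₁ := 60) (e₂ := -65) (e₃ := -20) (x := x)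
      (by norm_num) (by norm_num) ?_ ?_ hy (by rw [h]; ring)
    · rw [show (60 : ℚ) - (-65) = ((5 : ℕ) : ℚ) ^ 3 by norm_num, padicValRat.pow,
        padicValRat.of_nat, padicValNat_primes hp5, Nat.cast_zero, mul_zero]
    · rw [show (60 : ℚ) - (-20) = ((2 : ℕ) : ℚ) ^ 4 * ((5 : ℕ) : ℚ) by norm_num,
        padicValRat.mul (by norm_num) (by norm_num), padicValRat.pow, padicValRat.of_nat,
        padicValRat.of_nat, padicValNat_primes hp2, padicValNat_primes hp5, Nat.cast_zero, mul_zero,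
        add_zero]
  have P₂ : ∀ p : ℕ, p.Prime → p ≠ 3 → p ≠ 5 → Even (padicValRat p (x + 65)) := by
    intro p hp hp3 hp5
    haveI := Fact.mk hp
    have key := even_padicValRat_sub p (e₁ := -65) (e₂ := 60) (e₃ := -20) (x := x)
      (by norm_num) (by norm_num) ?_ ?_ hy (by rw [h]; ring)
    · rwa [sub_neg_eq_add] at key
    · rw [show (-65 : ℚ) - 60 = -(((5 : ℕ) : ℚ) ^ 3) by norm_num, padicValRat.neg,
        padicValRat.pow, padicValRat.of_nat, padicValNat_primes hp5, Nat.cast_zero, mul_zero]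
    · rw [show (-65 : ℚ) - (-20) = -(((3 : ℕ) : ℚ) ^ 2 * ((5 : ℕ) : ℚ)) by norm_num,
        padicValRat.neg, padicValRat.mul (by norm_num) (by norm_num), padicValRat.pow,
        padicValRat.of_nat, padicValRat.of_nat, padicValNat_primes hp3, padicValNat_primes hp5,
        Nat.cast_zero, mul_zero, add_zero]
  -- the square classes of `x - 60` away from `{2, 5}` and of `x + 65` away from `{3, 5}`
  obtain ⟨u, hu⟩ := exists_abs_eq_sq_or₂ hx₁ 2 5 P₁
  push_cast at hu
  have hu0 : u ≠ 0 := by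
    rintro rfl
    have : |x - 60| = 0 := by rcases hu with hu | hu | hu | hu <;> rw [hu] <;> ring
    exact hx₁ (abs_eq_zero.mp this)
  obtain ⟨w, hw⟩ := exists_abs_eq_sq_or₂ hx₂ 3 5 P₂
  push_cast at hw
  have hw0 : w ≠ 0 := by
    rintro rfl
    have : |x + 65| = 0 := by rcases hw with hw | hw | hw | hw <;> rw [hw] <;> ring
    exact hx₂ (abs_eq_zero.mp this)
  -- the sign of `x + 65`
  have hprod : 0 < (x - 60) * (x + 65) * (x + 20) := by rw [← hfac]; positivity
  have hpos₂ : 0 < x + 65 := by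
    by_contra hle
    push Not at hle
    have hn₁ : x - 60 < 0 := by linarith
    have hn₃ : x + 20 < 0 := by linarith
    nlinarith [mul_pos_of_neg_of_neg hn₁ hn₃, mul_nonpos_of_nonneg_of_nonpos
      (le_of_lt (mul_pos_of_neg_of_neg hn₁ hn₃)) hle]
  rw [abs_of_pos hpos₂] at hw
  -- the equation in the two shapes used by the local computations
  have h' : y ^ 2 = (x - 60) * ((x - 60) + 125) * ((x - 60) + 80) := by rw [h]; ring
  have h'' : y ^ 2 = (x + 65) * ((x + 65) - 125) * ((x + 65) - 45) := by rw [h]; ring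
  -- the squares modulo `16` and `3`, and the eight local computations
  have S₁₆ : ∀ z : ZMod 16, z ^ 2 ∈ ({0, 1, 4, 9} : Finset (ZMod 16)) := by decide
  have S₃ : ∀ z : ZMod 3, z ^ 2 ∈ ({0, 1} : Finset (ZMod 3)) := by decide
  have main₁ : x - 60 = u ^ 2 ∨ x - 60 = -5 * u ^ 2 := by
    rcases lt_or_gt_of_ne hx₁ with hneg | hpos
    · rw [abs_of_neg hneg] at hu
      rcases hu with hu | hu | hu | hu
      · exfalso
        rw [show x - 60 = -u ^ 2 by linarith] at h'
        refine not_sq_of_quartic 3 1 Nat.prime_three rfl _ S₃ (α := -1) (β := 125) (γ := 1)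
          (δ := -80) (by decide) (u := u) (W := y / u) ?_
        push_cast
        field_simp
        linear_combination h'
      · exfalso
        rw [show x - 60 = -2 * u ^ 2 by linarith] at h'
        refine not_sq_of_quartic 2 8 Nat.prime_two rfl _ S₁₆ (α := -2) (β := 125) (γ := 1)
          (δ := -40) (by decide) (u := u) (W := y / (2 * u)) ?_
        push_cast
        field_simp
        linear_combination h'
      · exact Or.inr (by linarith)
      · exfalso
        rw [show x - 60 = -10 * u ^ 2 by linarith] at h'
        refine not_sq_of_quartic 3 1 Nat.prime_three rfl _ S₃ (α := -10) (β := 125) (γ := 1)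
          (δ := -8) (by decide) (u := u) (W := y / (10 * u)) ?_
        push_cast
        field_simp
        linear_combination h'
    · rw [abs_of_pos hpos] at hu
      rcases hu with hu | hu | hu | hu
      · exact Or.inl hu
      · exfalso
        rw [hu] at h'
        refine not_sq_of_quartic 3 1 Nat.prime_three rfl _ S₃ (α := 1) (β := 40) (γ := 2)
          (δ := 125) (by decide) (u := u) (W := y / (2 * u)) ?_
        push_cast
        field_simp
        linear_combination h'
      · exfalso
        rw [hu] at h'
        refine not_sq_of_quartic 3 1 Nat.prime_three rfl _ S₃ (α := 5) (β := 125) (γ := 1)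
          (δ := 16) (by decide) (u := u) (W := y / (5 * u)) ?_
        push_cast
        field_simp
        linear_combination h'
      · exfalso
        rw [hu] at h'
        refine not_sq_of_quartic 2 8 Nat.prime_two rfl _ S₁₆ (α := 10) (β := 125) (γ := 1)
          (δ := 8) (by decide) (u := u) (W := y / (10 * u)) ?_
        push_cast
        field_simp
        linear_combination h'
  have main₂ : x + 65 = w ^ 2 ∨ x + 65 = 5 * w ^ 2 := by
    rcases hw with hw | hw | hw | hw
    · exact Or.inl hw
    · exfalso
      rw [hw] at h''
      refine not_sq_of_quartic 2 8 Nat.prime_two rfl _ S₁₆ (α := 3) (β := -125) (γ := 1)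
        (δ := -15) (by decide) (u := w) (W := y / (3 * w)) ?_
      push_cast
      field_simp
      linear_combination h''
    · exact Or.inr hw
    · exfalso
      rw [show x + 65 = 15 * w ^ 2 by linarith] at h''
      refine not_sq_of_quartic 2 8 Nat.prime_two rfl _ S₁₆ (α := 15) (β := -125) (γ := 1)
        (δ := -3) (by decide) (u := w) (W := y / (15 * w)) ?_
      push_cast
      field_simp
      linear_combination h''
  exact ⟨u, w, hu0, hw0, main₁, main₂⟩

/-! ### The curve `E₇₅`: equation, rational `2`-torsion `60, −65, −20`, the `2`-descent -/

/-- A solution of `y² = x³ + 25x² − 3800x − 78000` is an affine point of `E₇₅` (the affine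
equation, in the direction used to exhibit the torsion points). [folklore] -/
theorem equation_of_eq {x y : ℚ} (h : y ^ 2 = x ^ 3 + 25 * x ^ 2 - 3800 * x - 78000) :
    (⟨0, 25, 0, -3800, -78000⟩ : WeierstrassCurve ℚ).toAffine.Equation x y := by
  rw [Affine.equation_iff]
  linear_combination h

/-- The affine equation of `E₇₅` read as `y² = x³ + 25x² − 3800x − 78000`. [folklore] -/
theorem eq_of_equation {x y : ℚ}
    (h : (⟨0, 25, 0, -3800, -78000⟩ : WeierstrassCurve ℚ).toAffine.Equation x y) :
    y ^ 2 = x ^ 3 + 25 * x ^ 2 - 3800 * x - 78000 := by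
  rw [Affine.equation_iff] at h
  linear_combination h

/-- `E₇₅` has rational `2`-torsion with `e₁ = 60, e₂ = −65, e₃ = −20`: the `2`-division cubic is
`4x³ + b₂x² + 2b₄x + b₆ = 4x³ + 100x² − 15200x − 312000 = 4(x − 60)(x + 65)(x + 20)`, the
hypothesis `SplitTwoTorsion` of the tree's complete `2`-descent. [folklore] -/
theorem splitTwoTorsion :
    (⟨0, 25, 0, -3800, -78000⟩ : WeierstrassCurve ℚ).toAffine.SplitTwoTorsion 60 (-65) (-20) := by
  refine ⟨?_, ?_, ?_⟩ <;> norm_num [b₂, b₄, b₆]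

/-- An affine point of `E₇₅` with `y = 0` is one of the three `2`-torsion points,
`x ∈ {60, −65, −20}`. [folklore] -/
theorem x_eq_of_eq_zero {x y : ℚ}
    (h : (⟨0, 25, 0, -3800, -78000⟩ : WeierstrassCurve ℚ).toAffine.Equation x y) (hy : y = 0) :
    x = 60 ∨ x = -65 ∨ x = -20 := by
  have hE := eq_of_equation h
  rw [hy] at hE
  have hfac : (x - 60) * ((x + 65) * (x + 20)) = 0 := by linear_combination -hE
  rcases mul_eq_zero.mp hfac with h1 | h23
  · exact Or.inl (by linarith)
  · rcases mul_eq_zero.mp h23 with h2 | h3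
    · exact Or.inr (Or.inl (by linarith))
    · exact Or.inr (Or.inr (by linarith))

/-- **The image of the complete `2`-descent on `E₇₅`** (Silverman, *AEC*, Prop. X.1.4 and
Example X.1.5): for every rational point `P`, the pair of descent components
`(δ₁(P), δ₂(P)) = (x − 60, x + 65) ∈ ℚˣ/ℚˣ² × ℚˣ/ℚˣ²` (with the conventions at `O` and the `2`-torsion
points) is one of the four classes `(1, 1), (1, 5), (−5, 1), (−5, 5)`.  Polymorphic in the
`DecidableEq ℚ` argument of the tree's `twoDescentComponent`. [cite: SilvermanAEC2009, Prop. X.1.4 and Example X.1.5] -/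
theorem descentPair_mem [DecidableEq ℚ]
    (P : (⟨0, 25, 0, -3800, -78000⟩ : WeierstrassCurve ℚ).toAffine.Point) :
    (twoDescentComponent (⟨0, 25, 0, -3800, -78000⟩ : WeierstrassCurve ℚ).toAffine 60 (-65) (-20) P,
      twoDescentComponent (⟨0, 25, 0, -3800, -78000⟩ : WeierstrassCurve ℚ).toAffine (-65) 60 (-20) P)
      ∈ ({(1, 1), (1, sqClass 5), (sqClass (-5), 1), (sqClass (-5), sqClass 5)} :
        Set (SqUnits ℚ × SqUnits ℚ)) := by
  simp only [Set.mem_insert_iff, Set.mem_singleton_iff, Prod.mk.injEq]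
  rcases P with _ | ⟨x, y, hP⟩
  · exact Or.inl ⟨rfl, rfl⟩
  · by_cases hx1 : x = 60
    · subst hx1
      refine Or.inr (Or.inl ⟨?_, ?_⟩)
      · rw [twoDescentComponent_some_of_eq hP rfl,
          show ((60 : ℚ) - (-65)) * (60 - (-20)) = 100 ^ 2 by norm_num, sqClass_sq]
      · rw [twoDescentComponent_some_of_ne hP (by norm_num),
          show (60 : ℚ) - (-65) = 5 * 5 ^ 2 by norm_num, sqClass_mul_sq (by norm_num) (by norm_num)]
    by_cases hx2 : x = -65
    · subst hx2
      refine Or.inr (Or.inr (Or.inl ⟨?_, ?_⟩))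
      · rw [twoDescentComponent_some_of_ne hP (by norm_num),
          show (-65 : ℚ) - 60 = -5 * 5 ^ 2 by norm_num, sqClass_mul_sq (by norm_num) (by norm_num)]
      · rw [twoDescentComponent_some_of_eq hP rfl,
          show ((-65 : ℚ) - 60) * (-65 - (-20)) = 75 ^ 2 by norm_num, sqClass_sq]
    by_cases hx3 : x = -20
    · subst hx3
      refine Or.inr (Or.inr (Or.inr ⟨?_, ?_⟩))
      · rw [twoDescentComponent_some_of_ne hP (by norm_num),
          show (-20 : ℚ) - 60 = -5 * 4 ^ 2 by norm_num, sqClass_mul_sq (by norm_num) (by norm_num)]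
      · rw [twoDescentComponent_some_of_ne hP (by norm_num),
          show (-20 : ℚ) - (-65) = 5 * 3 ^ 2 by norm_num, sqClass_mul_sq (by norm_num) (by norm_num)]
    have hy : y ≠ 0 := fun hy => by
      rcases x_eq_of_eq_zero hP.1 hy with h | h | h
      · exact hx1 h
      · exact hx2 h
      · exact hx3 h
    obtain ⟨u, w, hu, hw, h1, h2⟩ := exists_sq_of_sq_eq hy (eq_of_equation hP.1)
    rw [twoDescentComponent_some_of_ne hP hx1, twoDescentComponent_some_of_ne hP hx2,
      show x - (-65) = x + 65 by ring]
    rcases h1 with h1 | h1 <;> rcases h2 with h2 | h2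
    · refine Or.inl ⟨?_, ?_⟩
      · rw [h1, sqClass_sq]
      · rw [h2, sqClass_sq]
    · refine Or.inr (Or.inl ⟨?_, ?_⟩)
      · rw [h1, sqClass_sq]
      · rw [h2, sqClass_mul_sq (by norm_num) hw]
    · refine Or.inr (Or.inr (Or.inl ⟨?_, ?_⟩))
      · rw [h1, sqClass_mul_sq (by norm_num) hu]
      · rw [h2, sqClass_sq]
    · refine Or.inr (Or.inr (Or.inr ⟨?_, ?_⟩))
      · rw [h1, sqClass_mul_sq (by norm_num) hu]
      · rw [h2, sqClass_mul_sq (by norm_num) hw]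

/-! ### Rank zero: `E₇₅(ℚ)` is finite -/

/-- **`E₇₅` (the twist of `X₀(15)` by `5`, conductor `75`) has Mordell–Weil rank `0`: `E₇₅(ℚ)` is
finite** (Cremona, *Algorithms for Modular Elliptic Curves*, Table 1, `N = 75`, class `B`: `r = 0`),
proved by the complete `2`-descent (Silverman, *AEC*, Prop. X.1.4, Example X.1.5): the `2`-descent
map `δ` (tree `twoDescentMap`, kernel `2E(ℚ)`) takes at most the `4` values of `descentPair_mem`,
while by the counting lemma `pow_finrank_add_two_le_natCard_range` (with the `2`-torsion points
`T₁ = (60, 0)`, `T₂ = (−65, 0)`, which `δ` separates: `δ(T₁) = (10000, 125)`, `δ(T₂) = (−125, 5625)`,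
`δ(T₁ + T₂) = (−1250000, 703125)`, and `5`, `−125`, `−1250000` are not rational squares) it takes at
least `2^(r + 2)` values, `r = rank_ℤ E(ℚ)` (Mordell–Weil, tree `module_finite_point_holds`); so
`r = 0` and `E(ℚ)` is finite (`finite_point_of_mordellWeilRank_eq_zero`).
[cite: SilvermanAEC2009, Prop. X.1.4 and Example X.1.5 (method); CremonaAlgorithms1997, Table 1, N = 75] -/
theorem finite_point : Finite (⟨0, 25, 0, -3800, -78000⟩ : WeierstrassCurve ℚ).toAffine.Point := by
  letI := Classical.decEq ℚ
  -- `Δ = 16·(125·80·45)² = 3240000000000 ≠ 0`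
  haveI : (⟨0, 25, 0, -3800, -78000⟩ : WeierstrassCurve ℚ).IsElliptic :=
    ⟨by
      rw [show (⟨0, 25, 0, -3800, -78000⟩ : WeierstrassCurve ℚ).Δ = 3240000000000 by
        norm_num [WeierstrassCurve.Δ, b₂, b₄, b₆, b₈]]
      norm_num⟩
  haveI : Module.Finite ℤ (⟨0, 25, 0, -3800, -78000⟩ : WeierstrassCurve ℚ).toAffine.Point :=
    WeierstrassCurve.module_finite_point_holds (W := ⟨0, 25, 0, -3800, -78000⟩)
  have h := splitTwoTorsion
  set ψ := twoDescentMap h with hψ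
  -- the `2`-torsion points `T₁ = (60, 0)`, `T₂ = (-65, 0)`
  have hns : ∀ {a b : ℚ}, (⟨0, 25, 0, -3800, -78000⟩ : WeierstrassCurve ℚ).toAffine.Equation a b →
      (⟨0, 25, 0, -3800, -78000⟩ : WeierstrassCurve ℚ).toAffine.Nonsingular a b :=
    fun hab => equation_iff_nonsingular.mp hab
  have hT₁ := hns (equation_of_eq (x := 60) (y := 0) (by norm_num))
  have hT₂ := hns (equation_of_eq (x := -65) (y := 0) (by norm_num))
  set T₁ := Point.some 60 0 hT₁ with hT₁def
  set T₂ := Point.some (-65) 0 hT₂ with hT₂def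
  have h12 : (60 : ℚ) ≠ -65 := by norm_num
  have h21 : (-65 : ℚ) ≠ 60 := by norm_num
  -- negative numbers and `5` are not squares
  have hnegsq : ∀ {c : ℚ}, c < 0 → sqClass c ≠ 1 := fun hc h1 => by
    obtain ⟨v, hv⟩ := (sqClass_eq_one_iff hc.ne).mp h1
    nlinarith [sq_nonneg v]
  have h5 : sqClass (5 : ℚ) ≠ 1 := fun h1 => by
    obtain ⟨v, hv⟩ := (sqClass_eq_one_iff (by norm_num)).mp h1
    exact five_ne_sq v hv
  have hψT₁ : ψ T₁ = Additive.ofMul (sqClass ((60 - (-65)) * (60 - (-20))), sqClass (60 - (-65))) := by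
    rw [hψ, twoDescentMap_apply, twoDescentComponent_some_of_eq hT₁ rfl,
      twoDescentComponent_some_of_ne hT₁ h12]
  have hψT₂ : ψ T₂ = Additive.ofMul (sqClass (-65 - 60), sqClass ((-65 - 60) * (-65 - (-20)))) := by
    rw [hψ, twoDescentMap_apply, twoDescentComponent_some_of_ne hT₂ h21,
      twoDescentComponent_some_of_eq hT₂ rfl]
  have h₁ : ψ T₁ ≠ 0 := by
    rw [hψT₁, Ne, ofMul_eq_zero, Prod.mk_eq_one, not_and_or]
    refine Or.inr ?_
    rw [show (60 : ℚ) - (-65) = 5 * 5 ^ 2 by norm_num, sqClass_mul_sq (by norm_num) (by norm_num)]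
    exact h5
  have h₂ : ψ T₂ ≠ 0 := by
    rw [hψT₂, Ne, ofMul_eq_zero, Prod.mk_eq_one, not_and_or]
    exact Or.inl (hnegsq (by norm_num))
  have h₃ : ψ (T₁ + T₂) ≠ 0 := by
    rw [map_add, hψT₁, hψT₂, ← ofMul_mul, Prod.mk_mul_mk, Ne, ofMul_eq_zero, Prod.mk_eq_one,
      not_and_or]
    refine Or.inl ?_
    rw [← sqClass_mul (by norm_num) (by norm_num)]
    exact hnegsq (by norm_num)
  have h₁₂ : ψ T₁ ≠ ψ T₂ := by
    rw [hψT₁, hψT₂, Ne, Additive.ofMul.apply_eq_iff_eq, Prod.mk.injEq, not_and_or]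
    refine Or.inl fun heq => hnegsq (c := (-65 : ℚ) - 60) (by norm_num) ?_
    rw [← heq, show ((60 : ℚ) - (-65)) * (60 - (-20)) = 100 ^ 2 by norm_num, sqClass_sq]
  have hker : ∀ a, ψ a = 0 → ∃ b, a = 2 • b := fun a ha => by
    have ha' : a ∈ ψ.ker := ha
    rw [hψ, ker_twoDescentMap h] at ha'
    obtain ⟨b, hb⟩ := ha'
    exact ⟨b, hb.symm⟩
  have hfin₁ : IsOfFinAddOrder T₁ := by
    refine isOfFinAddOrder_iff_nsmul_eq_zero.mpr ⟨2, two_pos, ?_⟩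
    rw [two_nsmul, hT₁def]
    exact add_self_of_Y_eq (by norm_num [negY])
  have hfin₂ : IsOfFinAddOrder T₂ := by
    refine isOfFinAddOrder_iff_nsmul_eq_zero.mpr ⟨2, two_pos, ?_⟩
    rw [two_nsmul, hT₂def]
    exact add_self_of_Y_eq (by norm_num [negY])
  -- the range of `ψ` has at most `4` elements
  set S : Set (SqUnits ℚ × SqUnits ℚ) := {(1, 1), (1, sqClass 5), (sqClass (-5), 1),
    (sqClass (-5), sqClass 5)} with hS
  have hSfin : S.Finite := (((Set.finite_singleton _).insert _).insert _).insert _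
  have hS4 : S.ncard ≤ 4 := by
    rw [hS]
    refine (Set.ncard_insert_le _ _).trans ?_
    refine (Nat.add_le_add_right (Set.ncard_insert_le _ _) 1).trans ?_
    refine (Nat.add_le_add_right (Nat.add_le_add_right (Set.ncard_insert_le _ _) 1) 1).trans ?_
    rw [Set.ncard_singleton]
  have hsub : Set.range ψ ⊆ Additive.ofMul '' S := by
    rintro _ ⟨P, rfl⟩
    exact ⟨_, descentPair_mem P, by rw [hψ]; exact (twoDescentMap_apply h P).symm⟩
  have hTfin : (Additive.ofMul '' S).Finite := hSfin.image _
  haveI : Finite ψ.range := (hTfin.subset (by rw [AddMonoidHom.coe_range]; exact hsub)).to_subtype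
  have hcard : Nat.card ψ.range ≤ 4 := by
    rw [← SetLike.coe_sort_coe, Nat.card_coe_set_eq, AddMonoidHom.coe_range]
    calc (Set.range ψ).ncard ≤ (Additive.ofMul '' S).ncard := Set.ncard_le_ncard hsub hTfin
      _ ≤ S.ncard := Set.ncard_image_le hSfin
      _ ≤ 4 := hS4
  have hbound := pow_finrank_add_two_le_natCard_range ψ hker hfin₁ hfin₂ h₁ h₂ h₃ h₁₂
  have hr : (⟨0, 25, 0, -3800, -78000⟩ : WeierstrassCurve ℚ).mordellWeilRank = 0 := by
    have hle :
        2 ^ (Module.finrank ℤ (⟨0, 25, 0, -3800, -78000⟩ : WeierstrassCurve ℚ).toAffine.Point + 2) ≤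
          2 ^ 2 := hbound.trans hcard
    have := (Nat.pow_le_pow_iff_right (by norm_num)).mp hle
    unfold WeierstrassCurve.mordellWeilRank
    omega
  exact WeierstrassCurve.finite_point_of_mordellWeilRank_eq_zero _ hr

end Twist75

end Summit.Langlands.Langlands.Theorems.SqrtFiveQuarticCovers

end
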